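import Summits.Ventures.DiscreteObjects.PP12.NoOrder157

/-!
# PP(12): the prime-order atlas, version 2 — five primes, `157` removed in the kernel
Framing: lottery ticket; floor = certified bounds/negative ranges.

`prime_order_atlas_order12` (`PrimeOrderAtlas.lean`) lists the fixed structure of every prime-order collineation of a
projective plane of order 12 for `p ∈ {2, 3, 5, 11, 13, 157}`. With `no_collineation_order_157` (`NoOrder157.lean`:
the cyclic / Singer case is impossible by Hall's multiplier theorem) the last entry disappears:
**`prime_order_atlas_order12_v2`** is the same conjunction with five branches. Cell `pub-namedobj`, target M; everything
proved, nothing assumed; no `sorry`, no new axioms. (In print the branches `p = 5, 11, 13` are excluded too —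
Janko–van Trung 1982 —, by computer searches that the census reproduces for `11` and `13` outside the kernel.)
-/

namespace Summit.Ventures.DiscreteObjects.PP12

open Configuration Finset
open scoped Classical

namespace Collineation

variable {P L : Type*} [Membership P L] [ProjectivePlane P L] [Fintype P] [Fintype L]
  [DecidableEq P] [DecidableEq L] (σ : Collineation P L)

/-- **Prime-order atlas for a projective plane of order 12, version 2 (five primes).** For a collineation `σ ≠ 1`
with `σ ^ p = 1` on points, `p` prime: `σ` fixes as many lines as points, and `p = 2` (elation, 13 fixed points),
or `p = 3` (elation; or planar of order 3; or flag type with 1, 4, 7 or 10 fixed points), or `p = 5` (a fixed Fano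
subplane), or `p = 11` (homology with 14 fixed points, or triangle), or `p = 13` (a unique fixed antiflag). -/
theorem prime_order_atlas_order12_v2 (h12 : ProjectivePlane.order P L = 12) (hne : σ.onPoints ≠ 1) {p : ℕ}
    (hp : p.Prime) (hq : σ.onPoints ^ p = 1) :
    fixedCard σ.onLines = fixedCard σ.onPoints ∧
    ((p = 2 ∧ ∃ (l : L) (c : P), σ.IsAxis l ∧ σ.IsCenter c ∧ c ∈ l ∧ fixedCard σ.onPoints = 13) ∨
     (p = 3 ∧ ((∃ (l : L) (c : P), σ.IsAxis l ∧ σ.IsCenter c ∧ c ∈ l ∧ fixedCard σ.onPoints = 13) ∨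
       (fixedCard σ.onPoints = 13 ∧ (∀ l : L, σ.onLines l = l → σ.fixedOnLine l = 4) ∧
         (∀ x : P, σ.onPoints x = x → σ.fixedThrough x = 4)) ∨
       (∃ (l : L) (c : P), σ.onLines l = l ∧ σ.onPoints c = c ∧ c ∈ l ∧ (∀ x : P, σ.onPoints x = x → x ∈ l) ∧
         (∀ m : L, σ.onLines m = m → c ∈ m) ∧
         (fixedCard σ.onPoints = 1 ∨ fixedCard σ.onPoints = 4 ∨ fixedCard σ.onPoints = 7 ∨
           fixedCard σ.onPoints = 10)))) ∨
     (p = 5 ∧ fixedCard σ.onPoints = 7 ∧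
       (∀ l : L, σ.onLines l = l → σ.fixedOnLine l = 3) ∧ (∀ x : P, σ.onPoints x = x → σ.fixedThrough x = 3)) ∨
     (p = 11 ∧ ((∃ (l : L) (c : P), σ.IsAxis l ∧ σ.IsCenter c ∧ c ∉ l ∧ fixedCard σ.onPoints = 14) ∨
       (fixedCard σ.onPoints = 3 ∧ ∀ l : L, σ.onLines l = l → ∀ [DecidablePred (· ∈ l)], σ.fixedOnLine l = 2))) ∨
     (p = 13 ∧ (∃! x : P, σ.onPoints x = x) ∧ (∃! l : L, σ.onLines l = l) ∧
       ∀ (x : P) (l : L), σ.onPoints x = x → σ.onLines l = l → x ∉ l)) := by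
  obtain ⟨hfix, h⟩ := σ.prime_order_atlas_order12 h12 hne hp hq
  refine ⟨hfix, ?_⟩
  rcases h with h | h | h | h | h | ⟨h157, -⟩
  · exact Or.inl h
  · exact Or.inr (Or.inl h)
  · exact Or.inr (Or.inr (Or.inl h))
  · exact Or.inr (Or.inr (Or.inr (Or.inl h)))
  · exact Or.inr (Or.inr (Or.inr (Or.inr h)))
  · subst h157
    exact (σ.no_collineation_order_157 h12 hne hq).elim

end Collineation

end Summit.Ventures.DiscreteObjects.PP12
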